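import Summits.QuantumFields.BalabanUV.Beta.GAN24.ContactOneGaugeCellBorder
import Summits.QuantumFields.BalabanUV.Beta.GAN24.Push3GaugeSlotCells
import Summits.QuantumFields.BalabanUV.Beta.GAN24.SrecLinearPartEq

/-!
# `GAN24.Push3BorderGaugeSlotCells` — CT-ROUTE step «CT-3aV-NEST»: A PURE-GAUGE LEG `dz λ` IN THE LEFT (fluctuation) OR TABLE (index) SLOT OF THE PUSH
# `push₃ l r w (reslot inl inr (vhSAt ρ))` OF THE BORDER TABLE's field–multiplier channel READS, ENTRY BY ENTRY, AS THE BORDER ONE-GAUGE CELL SUM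
# (multiplier leg OUTER), AND THE CELL BOUNDS IN THAT NESTING

HONEST FRAMING (cell charter, verbatim): «discharging `BetaPertH` makes Bałaban's UV stability UNCONDITIONAL — a real constructive-QFT result;
it is NOT the continuum limit and NOT the Clay problem.»  DERIVED cell leaf (pub-balaban, G-an2-4 formalisation swarm → CRUX TEAM (2), seat
`b2b-balaban-gan24-formalise-leaf-02`, gen 47): the plumbing between leaf-01 g43's first co-dressed push of a NON-ff source (`RespStepBm.e3K_coDressKBmAt_KStepUnit`:
the channels `push₃ (−R) (colM K̃ Lc) R (reslot inl inr V)` and `push₃ (rowMM K̃ Lc) R R (reslot inr inl V)` of the border table `V = vhSAt ρ d Lc` — its ff and mm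
channels are empty) as consumed by leaf-03's (E-α-V) `SrecBornSector`, and this lineage's CT-3aV cells (`ContactBorderPartner`, `ContactOneGaugeCellBorder`);
leaf-01 g58's `Push3GaugeSlotCells` pattern and its two finitely-supported Fubini lemmas BY NAME.  [folklore] finite-window bookkeeping; NO cited fact, NO `def`,
NO `def … : Prop`, NO wall binder; constants symbolic.  Discharges NO letter of (CONV-C); NEVER «G-an2-4 closed»; NOT hS0, NOT D1, NOT `BetaPertH`, NOT
continuum, NOT Clay.  «not in print; our bookkeeping».
HONEST DEPENDENCY (cell records, verbatim): «continuum YM on T⁴ ⇐ BetaPertH ∧ nine spine estimates (0/9 proved); BetaPertH ⇐ (D1) ∧ (D4) ∧ CAP+tail;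
G-an2-4 gates asym, D1 and NE2/3/4.»
ABSOLUTE RULE (cell charter, verbatim): «No internally-minted statement may enter as a cited fact. Every hypothesis is either kernel-proved in this
package or a verbatim quotation of a PUBLISHED theorem with page reference. The manuscript(s) under audit are NOT citable for their own disputed steps —
they are the thing under adjudication; programme-internal (2001/route/tribunal) claims are never citable.»

THE OBJECTS (generic `d`; the table's blocking `L ≥ 1`, box root `ρ = toSite rr`, `rr ∈ box (d+1) L`; `V := vhSAt ρ d L`, `q := linSymAt ρ L`; leg families
`l r w : Fin (d+1) → Site → Fin (d+1) → Site → ℝ` (coarse bond ↦ fine 1-form), gauge functions `λ μ y : Site → ℝ`; `Push3.push₃`, `Push4.vertexW`,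
`SrecLinearPartEq.reslot`).  For EVERY packed multiplier site `z` BOTH fine slots of `V κ u x z (inl a) (inr μ)` — the fluctuation site `x` and the background-bond
site `u` — lie in the finite `2L`-box `nearBox L (blk L z)` (`vhKerAt_eq_zero_left ∕ _right`): this is the only locality used.
## What is proved
* §1 windows: `vhSAt_inl_inr_eq_zero_of_not_mem_idx` (index site), `card_nearBox` (`= (2L)^{d+1}`), `l1_sub_le_of_mem_nearBox`.
* §2 LEFT SLOT (one finite exchange, hypothesis-free): `inner_gaugeLeft_border`, **`push₃_gaugeLeft_border`**
  `push₃ (dz λ) r w (reslot inl inr V) κ′ u′ x′ z′ (inl α) (inl β) = Σ'_z Σ_μ r β z′ μ z · Σ'_u Σ_κ w κ′ u′ κ u · ((λ_{αx′}(u + e_κ) − λ_{αx′}(z + ρ + L·e_μ)) · q(u,z)(inl κ)(inr μ))`.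
* §3 TABLE SLOT (hypothesis-free): `vertexW_dz_border`, **`push₃_gaugeTable_border`**
  `push₃ l r (dz λ) (reslot inl inr V) κ′ u′ x′ z′ (inl α) (inl β) = Σ'_z Σ_μ r β z′ μ z · Σ'_x Σ_a l α x′ a x · ((λ_{κ′u′}(z + ρ) − λ_{κ′u′} x) · q(x,z)(inl a)(inr μ))`.
* §4 THE CELL BOUNDS IN THIS NESTING (multiplier leg OUTER; inner sum FINITE over the `(2L)^{d+1}`-box, one wobble, g46's free block sum): **`abs_cell_border_le'`**
  `|Σ'_z Σ_μ M μ z · Σ'_u Σ_κ T κ u · K κ u μ z| ≤ (d+1)²·(2L)^{d+1}·e^{2κ₀(d+1)·2L}·E₁E₃E_K·(N^{d+1}·Zl(κ₀∕(4(d+1)))·e^{−(κ₀∕12)(‖z₁−z₀‖∞+‖z₃−z₀‖∞)})`, and the two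
  instances **`abs_cellVflu_le'`**, **`abs_cellVidx_le'`** (kernels of `ContactBorderPartner`).
NOT HERE: the `reslot inr inl` channel (= these with the table's slots exchanged, `vhSAt_symm`; its right-slot reading needs the diagonal-window exchange of
`Push3GaugeSlotCells.tsum_comm_of_window` — sequel on word), the Λ channel (ff-valued: leaf-01's `Push3GaugeSlotCells` script applies verbatim with
`HessianGaugeLegContact.tsum_dz_mul_SLam_hessFFAt`), any assembly.
Provenance: seat b2b-balaban-gan24-formalise-leaf-02 gen 47 (prover-…-leaf-02-g47-0), 2026-08-21; over the files named above BY NAME.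
-/

open Finset
open scoped BigOperators Nat
open Literature.MathematicalPhysics.QuantumFieldTheory.LatticeForm (quo)
open Literature.MathematicalPhysics.QuantumFieldTheory.Balaban1983to89
open Literature.MathematicalPhysics.QuantumFieldTheory.Balaban1983to89.Beta
open AffineAveraging AveragingContours AveragingHessianKernels AveragingContoursRooted AveragingHessianKernelsRooted
open B12Sec2to5 (l1 l1_nonneg)
open B4ContourShift (supNorm supNorm_nonneg)
open ExpKernelCalculus (MKer Zl Zl_nonneg Zl_pos)
open OneStepResolventKernel (Fib)
open Summit.QuantumFields.BalabanUV.Beta.AveragingWardRootedStencils (linSymAt linSymAt_inl_inr)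
open Summit.QuantumFields.BalabanUV.Beta.LinearGaugeVH (nearBox mem_nearBox summable_of_finsupp)
open Summit.QuantumFields.BalabanUV.Beta.GAN24.EnvelopeBlockSum (env_wobble env_le_one summable_env)
open Summit.QuantumFields.BalabanUV.Beta.GAN24.ContactOneGaugeCellBound (tsum_env3_le)
open Summit.QuantumFields.BalabanUV.Beta.GAN24.BorderGaugeLegContact (tsum_dz_mul_vhSAt vhSAt_inl_inr_eq_zero_of_not_mem)
open Summit.QuantumFields.BalabanUV.Beta.GAN24.ContactBorderPartner (off_eq_zero_and_near_of_linSymAt_ne_zero tsum_dz_mul_vhSAt_idx_inl_inr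
  abs_fluWeight_mul_linSymAt_le abs_idxWeight_mul_linSymAt_le)
open Summit.QuantumFields.BalabanUV.Beta.GAN24.Push4 (vertexW vertexW_apply)
open Summit.QuantumFields.BalabanUV.Beta.GAN24.Push3 (push₃ push₃_inl_inl)
open Summit.QuantumFields.BalabanUV.Beta.GAN24.Push3GaugeSlotCells (tsum_tsum_comm_of_windows)
open Summit.QuantumFields.BalabanUV.Beta.GAN24.SrecLinearPartEq (reslot reslot_inl_inl)

noncomputable section

namespace Summit.QuantumFields.BalabanUV.Beta.GAN24.Push3BorderGaugeSlotCells

variable {d : ℕ}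
variable (l r w : Fin (d + 1) → (Fin (d + 1) → ℤ) → Fin (d + 1) → (Fin (d + 1) → ℤ) → ℝ)
variable (lam : Fin (d + 1) → (Fin (d + 1) → ℤ) → (Fin (d + 1) → ℤ) → ℝ)

/-! ## §1 Windows -/

/-- [folklore] For a box root the `(inl a, inr μ)` entry vanishes unless the BACKGROUND-bond site `u` lies in the support box of the multiplier leg's block
(`vhKerAt_eq_zero_right` through the packer). -/
theorem vhSAt_inl_inr_eq_zero_of_not_mem_idx {L : ℕ} {rr : Fin (d + 1) → ℕ} (hrr : rr ∈ box (d + 1) L) (κ : Fin (d + 1)) (x z : Fin (d + 1) → ℤ)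
    (a μ : Fin (d + 1)) {u : Fin (d + 1) → ℤ} (hu : u ∉ nearBox L (blk L z)) :
    vhSAt (toSite rr) d L rfl κ u x z (Sum.inl a) (Sum.inr μ) = 0 := by
  rw [mem_nearBox] at hu
  simp only [vhSAt, packVH_inl_inr]
  split_ifs
  · exact vhKerAt_eq_zero_right hrr _ (f' := (κ, u)) hu
  · rfl

/-- [folklore] The support box of a block has `(2L)^{d+1}` sites. -/
theorem card_nearBox (L : ℕ) (y : Fin (d + 1) → ℤ) : (nearBox L y).card = (2 * L) ^ (d + 1) := by
  rw [nearBox, Fintype.card_piFinset]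
  rw [show (2 * L) ^ (d + 1) = ∏ _i : Fin (d + 1), (2 * L) by simp]
  refine Finset.prod_congr rfl fun i _ => ?_
  rw [Int.card_Icc]
  omega

/-- [folklore] A site of the support box of the block of a PACKED site `z` (`off L z = 0`) is within `|·|₁ ≤ (d+1)·2L` of `z`. -/
theorem l1_sub_le_of_mem_nearBox {L : ℕ} (hL : 1 ≤ L) {z u : Fin (d + 1) → ℤ} (hz : off L z = 0) (hu : u ∈ nearBox L (blk L z)) :
    l1 (u - z) ≤ ((d : ℝ) + 1) * (2 * (L : ℝ)) := by
  rw [mem_nearBox] at hu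
  have hzb : z = (L : ℤ) • blk L z := eq_smul_blk_of_off_eq_zero hL hz
  unfold l1
  calc ∑ ν, |(((u - z) ν : ℤ) : ℝ)| ≤ ∑ _ν : Fin (d + 1), 2 * (L : ℝ) := by
        refine Finset.sum_le_sum fun i _ => ?_
        obtain ⟨h1, h2⟩ := hu i
        have hzi : z i = (L : ℤ) * blk L z i := by
          have := congrArg (fun f => f i) hzb
          simpa [Pi.smul_apply, smul_eq_mul] using this
        rw [abs_le]
        simp only [Pi.sub_apply]
        push_cast
        have e1 : (L : ℝ) * (blk L z i : ℝ) ≤ ((u i : ℤ) : ℝ) := by exact_mod_cast h1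
        have e2 : ((u i : ℤ) : ℝ) ≤ (L : ℝ) * (blk L z i : ℝ) + (2 * (L : ℝ) - 1) := by exact_mod_cast h2
        have e3 : ((z i : ℤ) : ℝ) = (L : ℝ) * (blk L z i : ℝ) := by exact_mod_cast hzi
        constructor <;> linarith
    _ = ((d : ℝ) + 1) * (2 * (L : ℝ)) := by
        rw [Finset.sum_const, Finset.card_univ, Fintype.card_fin, nsmul_eq_mul]; push_cast; ring

/-! ## §2 THE LEFT SLOT: a pure-gauge fluctuation-slot leg reads as the border cell (multiplier leg outer; one finite exchange) -/

/-- [folklore] **THE LEFT LEG AGAINST THE TABLE VERTEX, INDEX LEG OUTSIDE** (box root; one exchange of two FINITELY supported lattice sums — the fluctuation site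
and the index site both lie in the `2L`-box of the multiplier site's block — then `BorderGaugeLegContact.tsum_dz_mul_vhSAt` under the binders):
`Σ'_x Σ_a (dz ψ)_a x · vertexW w (reslot inl inr V) κ′ u′ x z (inl a) (inl μ) = Σ'_u Σ_κ w κ′ u′ κ u · ((ψ(u + e_κ) − ψ(z + ρ + L·e_μ)) · q(u,z)(inl κ)(inr μ))`. -/
theorem inner_gaugeLeft_border {L : ℕ} (hL : 1 ≤ L) {rr : Fin (d + 1) → ℕ} (hrr : rr ∈ box (d + 1) L) (ψ : (Fin (d + 1) → ℤ) → ℝ)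
    (κ' : Fin (d + 1)) (u' z : Fin (d + 1) → ℤ) (μ : Fin (d + 1)) :
    ∑' x, ∑ a, dz ψ a x * vertexW w (reslot Sum.inl Sum.inr (vhSAt (toSite rr) d L rfl)) κ' u' x z (Sum.inl a) (Sum.inl μ)
      = ∑' u, ∑ κ, w κ' u' κ u *
          ((ψ (u + unitVec κ) - ψ (z + toSite rr + (L : ℤ) • unitVec μ)) * linSymAt (toSite rr) L u z (Sum.inl κ) (Sum.inr μ)) := by
  classical
  set V := vhSAt (toSite rr) d L rfl with hV
  -- finite windows in BOTH fine slots about the multiplier site's block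
  have hsu : ∀ x a κ, Summable fun u => dz ψ a x * (w κ' u' κ u * V κ u x z (Sum.inl a) (Sum.inr μ)) := by
    intro x a κ
    refine summable_of_finsupp (nearBox L (blk L z)) fun u hu => ?_
    rw [hV, vhSAt_inl_inr_eq_zero_of_not_mem_idx hrr κ x z a μ hu, mul_zero, mul_zero]
  have hsx : ∀ u a κ, Summable fun x => dz ψ a x * (w κ' u' κ u * V κ u x z (Sum.inl a) (Sum.inr μ)) := by
    intro u a κ
    refine summable_of_finsupp (nearBox L (blk L z)) fun x hx => ?_
    rw [hV, vhSAt_inl_inr_eq_zero_of_not_mem hrr κ u z a μ hx, mul_zero, mul_zero]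
  -- the left-hand side as an iterated sum `Σ'_x Σ'_u Φ x u`
  have hLHS : ∀ x, (∑ a, dz ψ a x * vertexW w (reslot Sum.inl Sum.inr V) κ' u' x z (Sum.inl a) (Sum.inl μ))
      = ∑' u, ∑ a, ∑ κ, dz ψ a x * (w κ' u' κ u * V κ u x z (Sum.inl a) (Sum.inr μ)) := by
    intro x
    calc (∑ a, dz ψ a x * vertexW w (reslot Sum.inl Sum.inr V) κ' u' x z (Sum.inl a) (Sum.inl μ))
        = ∑ a, ∑ κ, ∑' u, dz ψ a x * (w κ' u' κ u * V κ u x z (Sum.inl a) (Sum.inr μ)) := by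
          refine Finset.sum_congr rfl fun a _ => ?_
          rw [vertexW_apply, Finset.mul_sum]
          refine Finset.sum_congr rfl fun κ _ => ?_
          rw [← tsum_mul_left]
          exact tsum_congr fun u => by rw [reslot_inl_inl]
      _ = ∑ a, ∑' u, ∑ κ, dz ψ a x * (w κ' u' κ u * V κ u x z (Sum.inl a) (Sum.inr μ)) := by
          refine Finset.sum_congr rfl fun a _ => ?_
          rw [Summable.tsum_finsetSum fun κ _ => hsu x a κ]
      _ = _ := by rw [Summable.tsum_finsetSum fun a _ => summable_sum fun κ _ => hsu x a κ]
  -- the right-hand side as the iterated sum `Σ'_u Σ'_x Φ x u`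
  have hRHS : ∀ u, (∑ κ, w κ' u' κ u * ∑' x, ∑ a, dz ψ a x * V κ u x z (Sum.inl a) (Sum.inr μ))
      = ∑' x, ∑ a, ∑ κ, dz ψ a x * (w κ' u' κ u * V κ u x z (Sum.inl a) (Sum.inr μ)) := by
    intro u
    have hs1 : ∀ κ a, Summable fun x => dz ψ a x * V κ u x z (Sum.inl a) (Sum.inr μ) := by
      intro κ a
      refine summable_of_finsupp (nearBox L (blk L z)) fun x hx => ?_
      rw [hV, vhSAt_inl_inr_eq_zero_of_not_mem hrr κ u z a μ hx, mul_zero]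
    calc (∑ κ, w κ' u' κ u * ∑' x, ∑ a, dz ψ a x * V κ u x z (Sum.inl a) (Sum.inr μ))
        = ∑ κ, ∑ a, ∑' x, dz ψ a x * (w κ' u' κ u * V κ u x z (Sum.inl a) (Sum.inr μ)) := by
          refine Finset.sum_congr rfl fun κ _ => ?_
          rw [Summable.tsum_finsetSum fun a _ => hs1 κ a, Finset.mul_sum]
          refine Finset.sum_congr rfl fun a _ => ?_
          rw [← tsum_mul_left]
          exact tsum_congr fun x => by ring
      _ = ∑ a, ∑ κ, ∑' x, dz ψ a x * (w κ' u' κ u * V κ u x z (Sum.inl a) (Sum.inr μ)) := Finset.sum_comm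
      _ = ∑ a, ∑' x, ∑ κ, dz ψ a x * (w κ' u' κ u * V κ u x z (Sum.inl a) (Sum.inr μ)) := by
          refine Finset.sum_congr rfl fun a _ => ?_
          rw [Summable.tsum_finsetSum fun κ _ => hsx u a κ]
      _ = _ := by rw [Summable.tsum_finsetSum fun a _ => summable_sum fun κ _ => hsx u a κ]
  -- exchange the two finitely supported sums
  have hX : ∀ x ∉ nearBox L (blk L z), ∀ u,
      (∑ a, ∑ κ, dz ψ a x * (w κ' u' κ u * V κ u x z (Sum.inl a) (Sum.inr μ))) = 0 := by
    intro x hx u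
    refine Finset.sum_eq_zero fun a _ => Finset.sum_eq_zero fun κ _ => ?_
    rw [hV, vhSAt_inl_inr_eq_zero_of_not_mem hrr κ u z a μ hx, mul_zero, mul_zero]
  have hU : ∀ u ∉ nearBox L (blk L z), ∀ x,
      (∑ a, ∑ κ, dz ψ a x * (w κ' u' κ u * V κ u x z (Sum.inl a) (Sum.inr μ))) = 0 := by
    intro u hu x
    refine Finset.sum_eq_zero fun a _ => Finset.sum_eq_zero fun κ _ => ?_
    rw [hV, vhSAt_inl_inr_eq_zero_of_not_mem_idx hrr κ x z a μ hu, mul_zero, mul_zero]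
  rw [tsum_congr hLHS, tsum_tsum_comm_of_windows (Φ := fun x u => ∑ a, ∑ κ, dz ψ a x * (w κ' u' κ u * V κ u x z (Sum.inl a) (Sum.inr μ)))
    _ _ hX hU]
  refine tsum_congr fun u => ?_
  rw [← hRHS u]
  refine Finset.sum_congr rfl fun κ _ => ?_
  rw [hV, tsum_dz_mul_vhSAt hL hrr κ u z μ ψ]

/-- [folklore] **THE LEFT SLOT** (hypothesis-free): with a pure-gauge LEFT (fluctuation-slot) leg family, every field entry of the push of the border table's
field–multiplier channel is the border one-gauge cell sum, multiplier leg OUTER, index leg INSIDE: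
`push₃ (dz λ) r w (reslot inl inr V) κ′ u′ x′ z′ (inl α) (inl β) = Σ'_z Σ_μ r β z′ μ z · Σ'_u Σ_κ w κ′ u′ κ u · ((λ_{αx′}(u + e_κ) − λ_{αx′}(z + ρ + L·e_μ)) · q(u,z)(inl κ)(inr μ))`. -/
theorem push₃_gaugeLeft_border {L : ℕ} (hL : 1 ≤ L) {rr : Fin (d + 1) → ℕ} (hrr : rr ∈ box (d + 1) L) (κ' : Fin (d + 1))
    (u' x' z' : Fin (d + 1) → ℤ) (α β : Fin (d + 1)) :
    push₃ (fun μ y κ u => dz (lam μ y) κ u) r w (reslot Sum.inl Sum.inr (vhSAt (toSite rr) d L rfl)) κ' u' x' z' (Sum.inl α) (Sum.inl β)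
      = ∑' z, ∑ μ, r β z' μ z * ∑' u, ∑ κ, w κ' u' κ u *
          ((lam α x' (u + unitVec κ) - lam α x' (z + toSite rr + (L : ℤ) • unitVec μ)) * linSymAt (toSite rr) L u z (Sum.inl κ) (Sum.inr μ)) := by
  rw [push₃_inl_inl]
  refine tsum_congr fun z => Finset.sum_congr rfl fun μ _ => ?_
  rw [mul_comm, inner_gaugeLeft_border w hL hrr (lam α x') κ' u' z μ]

/-! ## §3 THE TABLE SLOT: a pure-gauge index leg reads as the index-slot border cell (hypothesis-free) -/

/-- [folklore] The table vertex of the border channel through pure-gauge TABLE legs `(κ, y) ↦ dz (λ κ y)`: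
`vertexW (dz λ) (reslot inl inr V) κ′ u′ x z (inl a) (inl μ) = (λ_{κ′u′}(z + ρ) − λ_{κ′u′} x) · q(x,z)(inl a)(inr μ)` (`ContactBorderPartner.tsum_dz_mul_vhSAt_idx_inl_inr`). -/
theorem vertexW_dz_border {L : ℕ} (hL : 1 ≤ L) {rr : Fin (d + 1) → ℕ} (hrr : rr ∈ box (d + 1) L) (κ' : Fin (d + 1)) (u' x z : Fin (d + 1) → ℤ)
    (a μ : Fin (d + 1)) :
    vertexW (fun κ y κ₁ u => dz (lam κ y) κ₁ u) (reslot Sum.inl Sum.inr (vhSAt (toSite rr) d L rfl)) κ' u' x z (Sum.inl a) (Sum.inl μ)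
      = (lam κ' u' (z + toSite rr) - lam κ' u' x) * linSymAt (toSite rr) L x z (Sum.inl a) (Sum.inr μ) := by
  classical
  have hs : ∀ κ, Summable fun u => dz (lam κ' u') κ u * vhSAt (toSite rr) d L rfl κ u x z (Sum.inl a) (Sum.inr μ) := by
    intro κ
    refine summable_of_finsupp (nearBox L (blk L z)) fun u hu => ?_
    rw [vhSAt_inl_inr_eq_zero_of_not_mem_idx hrr κ x z a μ hu, mul_zero]
  rw [vertexW_apply, ← tsum_dz_mul_vhSAt_idx_inl_inr hL hrr x z a μ (lam κ' u')]
  simp only [reslot_inl_inl]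
  exact (Summable.tsum_finsetSum fun κ _ => hs κ).symm

/-- [folklore] **THE TABLE SLOT** (hypothesis-free): with a pure-gauge TABLE (index) leg family, every field entry of the push of the border channel is the index-slot
border cell sum, multiplier leg OUTER, fluctuation-slot leg INSIDE:
`push₃ l r (dz λ) (reslot inl inr V) κ′ u′ x′ z′ (inl α) (inl β) = Σ'_z Σ_μ r β z′ μ z · Σ'_x Σ_a l α x′ a x · ((λ_{κ′u′}(z + ρ) − λ_{κ′u′} x) · q(x,z)(inl a)(inr μ))`. -/
theorem push₃_gaugeTable_border {L : ℕ} (hL : 1 ≤ L) {rr : Fin (d + 1) → ℕ} (hrr : rr ∈ box (d + 1) L) (κ' : Fin (d + 1))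
    (u' x' z' : Fin (d + 1) → ℤ) (α β : Fin (d + 1)) :
    push₃ l r (fun κ y κ₁ u => dz (lam κ y) κ₁ u) (reslot Sum.inl Sum.inr (vhSAt (toSite rr) d L rfl)) κ' u' x' z' (Sum.inl α) (Sum.inl β)
      = ∑' z, ∑ μ, r β z' μ z * ∑' x, ∑ a, l α x' a x *
          ((lam κ' u' (z + toSite rr) - lam κ' u' x) * linSymAt (toSite rr) L x z (Sum.inl a) (Sum.inr μ)) := by
  rw [push₃_inl_inl]
  refine tsum_congr fun z => Finset.sum_congr rfl fun μ _ => ?_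
  rw [mul_comm]
  congr 1
  refine tsum_congr fun x => Finset.sum_congr rfl fun a _ => ?_
  rw [vertexW_dz_border lam hL hrr]

/-! ## §4 The border cell bounds in the push nesting (multiplier leg OUTER) -/

section Cell

variable {l r w lam}
variable {N L : ℕ} {κ₀ : ℝ} {rr : Fin (d + 1) → ℕ}

/-- [folklore] **THE INNER (FINE-LEG) SUM OVER THE SUPPORT BOX**: for a fine leg `|T κ u| ≤ E₁·E_{z₁}(u)` and a kernel `K κ u μ z` supported where `q(u,z)(inl κ)(inr μ) ≠ 0`
and bounded by `E_K·E_{z₀}(u)`: `|Σ'_u Σ_κ T κ u · K κ u μ z| ≤ (d+1)·(2L)^{d+1}·e^{2κ₀(d+1)·2L}·E₁·E_K·E_{z₁}(z)·E_{z₀}(z)` (the `u`-sum is finite over the `2L`-box of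
`blk L z`, every term within `(d+1)·2L` of `z`: two wobbles). -/
theorem abs_inner_le' (hN : 1 ≤ N) (hκ : 0 ≤ κ₀) (hL : 1 ≤ L) (hrr : rr ∈ box (d + 1) L) {T : Form1 (d + 1) ℝ}
    {K : Fin (d + 1) → (Fin (d + 1) → ℤ) → Fin (d + 1) → (Fin (d + 1) → ℤ) → ℝ} {z₀ z₁ : Fin (d + 1) → ℤ} {E₁ EK : ℝ} (hE₁ : 0 ≤ E₁) (hEK : 0 ≤ EK)
    (hT : ∀ κ u, |T κ u| ≤ E₁ * Real.exp (-(κ₀ * supNorm (quo N u - z₁))))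
    (hKsupp : ∀ κ u μ z, K κ u μ z ≠ 0 → linSymAt (toSite rr) L u z (Sum.inl κ) (Sum.inr μ) ≠ 0)
    (hK : ∀ κ u μ z, |K κ u μ z| ≤ EK * Real.exp (-(κ₀ * supNorm (quo N u - z₀)))) (μ : Fin (d + 1)) (z : Fin (d + 1) → ℤ) :
    (Summable fun u => ∑ κ, T κ u * K κ u μ z) ∧
    |∑' u, ∑ κ, T κ u * K κ u μ z| ≤
      ((d : ℝ) + 1) * (2 * (L : ℝ)) ^ (d + 1) * Real.exp (2 * (κ₀ * (((d : ℝ) + 1) * (2 * (L : ℝ))))) * E₁ * EK *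
        (Real.exp (-(κ₀ * supNorm (quo N z - z₁))) * Real.exp (-(κ₀ * supNorm (quo N z - z₀)))) := by
  classical
  set S : Finset (Fin (d + 1) → ℤ) := nearBox L (blk L z) with hS
  have hzero : ∀ u ∉ S, (∑ κ, T κ u * K κ u μ z) = 0 := by
    intro u hu
    refine Finset.sum_eq_zero fun κ _ => ?_
    by_cases hKz : K κ u μ z = 0
    · rw [hKz, mul_zero]
    · exfalso
      obtain ⟨-, hnear⟩ := off_eq_zero_and_near_of_linSymAt_ne_zero hrr (hKsupp κ u μ z hKz)
      exact hu (mem_nearBox.2 hnear)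
  have hsum : Summable fun u => ∑ κ, T κ u * K κ u μ z := summable_of_finsupp S hzero
  refine ⟨hsum, ?_⟩
  rw [tsum_eq_sum (s := S) (fun u hu => hzero u hu)]
  set B : ℝ := Real.exp (2 * (κ₀ * (((d : ℝ) + 1) * (2 * (L : ℝ))))) * E₁ * EK *
      (Real.exp (-(κ₀ * supNorm (quo N z - z₁))) * Real.exp (-(κ₀ * supNorm (quo N z - z₀)))) with hB
  have hB0 : 0 ≤ B := by positivity
  -- terms off the packer's support vanish; on it, every `u ∈ S` is within `(d+1)·2L` of `z`
  have hterm : ∀ u ∈ S, |∑ κ, T κ u * K κ u μ z| ≤ ((d : ℝ) + 1) * B := by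
    intro u hu
    by_cases hz : off L z = 0
    · have hl1 : l1 (u - z) ≤ ((d : ℝ) + 1) * (2 * (L : ℝ)) := l1_sub_le_of_mem_nearBox hL hz hu
      have hw1 : Real.exp (-(κ₀ * supNorm (quo N u - z₁)))
          ≤ Real.exp (κ₀ * (((d : ℝ) + 1) * (2 * (L : ℝ)))) * Real.exp (-(κ₀ * supNorm (quo N z - z₁))) := by
        refine (env_wobble hN hκ z₁ z u).trans ?_; gcongr
      have hw0 : Real.exp (-(κ₀ * supNorm (quo N u - z₀)))
          ≤ Real.exp (κ₀ * (((d : ℝ) + 1) * (2 * (L : ℝ)))) * Real.exp (-(κ₀ * supNorm (quo N z - z₀))) := by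
        refine (env_wobble hN hκ z₀ z u).trans ?_; gcongr
      calc |∑ κ, T κ u * K κ u μ z| ≤ ∑ κ, |T κ u * K κ u μ z| := Finset.abs_sum_le_sum_abs _ _
        _ ≤ ∑ _κ : Fin (d + 1), B := by
            refine Finset.sum_le_sum fun κ _ => ?_
            rw [abs_mul]
            calc |T κ u| * |K κ u μ z|
                ≤ (E₁ * Real.exp (-(κ₀ * supNorm (quo N u - z₁)))) * (EK * Real.exp (-(κ₀ * supNorm (quo N u - z₀)))) :=
                  mul_le_mul (hT κ u) (hK κ u μ z) (abs_nonneg _) (by positivity)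
              _ ≤ (E₁ * (Real.exp (κ₀ * (((d : ℝ) + 1) * (2 * (L : ℝ)))) * Real.exp (-(κ₀ * supNorm (quo N z - z₁))))) *
                    (EK * (Real.exp (κ₀ * (((d : ℝ) + 1) * (2 * (L : ℝ)))) * Real.exp (-(κ₀ * supNorm (quo N z - z₀))))) := by gcongr
              _ = B := by rw [hB, show (2 : ℝ) * (κ₀ * (((d : ℝ) + 1) * (2 * (L : ℝ)))) = κ₀ * (((d : ℝ) + 1) * (2 * (L : ℝ))) +
                    κ₀ * (((d : ℝ) + 1) * (2 * (L : ℝ))) by ring, Real.exp_add]; ring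
        _ = ((d : ℝ) + 1) * B := by rw [Finset.sum_const, Finset.card_univ, Fintype.card_fin, nsmul_eq_mul]; push_cast; ring
    · -- off the packer's support every `K κ u μ z` vanishes
      have h0 : (∑ κ, T κ u * K κ u μ z) = 0 := by
        refine Finset.sum_eq_zero fun κ _ => ?_
        by_cases hKz : K κ u μ z = 0
        · rw [hKz, mul_zero]
        · exact absurd (off_eq_zero_and_near_of_linSymAt_ne_zero hrr (hKsupp κ u μ z hKz)).1 hz
      rw [h0, abs_zero]; positivity
  have hcard : (S.card : ℝ) = (2 * (L : ℝ)) ^ (d + 1) := by rw [hS, card_nearBox]; push_cast; ring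
  calc |∑ u ∈ S, ∑ κ, T κ u * K κ u μ z| ≤ ∑ u ∈ S, |∑ κ, T κ u * K κ u μ z| := Finset.abs_sum_le_sum_abs _ _
    _ ≤ S.card • (((d : ℝ) + 1) * B) := Finset.sum_le_card_nsmul _ _ _ hterm
    _ = _ := by rw [nsmul_eq_mul, hcard, hB]; ring

/-- [folklore] **THE GENERIC BORDER CELL BOUND IN THE PUSH NESTING** (multiplier leg `M` OUTER with `|M μ z| ≤ E₃·E_{z₃}(z)`, fine leg `T` INSIDE, any contact kernel supported
on the packed kernel's support and enveloped at the fine leg site):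
`|Σ'_z Σ_μ M μ z · Σ'_u Σ_κ T κ u · K κ u μ z| ≤ (d+1)²·(2L)^{d+1}·e^{2κ₀(d+1)·2L}·E₁E₃E_K·(N^{d+1}·Zl(κ₀∕(4(d+1)))·e^{−(κ₀∕12)(‖z₁−z₀‖∞+‖z₃−z₀‖∞)})`. -/
theorem abs_cell_border_le' (hN : 1 ≤ N) (hκ : 0 < κ₀) (hL : 1 ≤ L) (hrr : rr ∈ box (d + 1) L) {T : Form1 (d + 1) ℝ} {M : Fin (d + 1) → (Fin (d + 1) → ℤ) → ℝ}
    {K : Fin (d + 1) → (Fin (d + 1) → ℤ) → Fin (d + 1) → (Fin (d + 1) → ℤ) → ℝ} {z₀ z₁ z₃ : Fin (d + 1) → ℤ} {E₁ E₃ EK : ℝ}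
    (hE₁ : 0 ≤ E₁) (hE₃ : 0 ≤ E₃) (hEK : 0 ≤ EK)
    (hT : ∀ κ u, |T κ u| ≤ E₁ * Real.exp (-(κ₀ * supNorm (quo N u - z₁))))
    (hM : ∀ μ z, |M μ z| ≤ E₃ * Real.exp (-(κ₀ * supNorm (quo N z - z₃))))
    (hKsupp : ∀ κ u μ z, K κ u μ z ≠ 0 → linSymAt (toSite rr) L u z (Sum.inl κ) (Sum.inr μ) ≠ 0)
    (hK : ∀ κ u μ z, |K κ u μ z| ≤ EK * Real.exp (-(κ₀ * supNorm (quo N u - z₀)))) :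
    (Summable fun z => ∑ μ, M μ z * ∑' u, ∑ κ, T κ u * K κ u μ z) ∧
    |∑' z, ∑ μ, M μ z * ∑' u, ∑ κ, T κ u * K κ u μ z| ≤
      ((d : ℝ) + 1) ^ 2 * (2 * (L : ℝ)) ^ (d + 1) * Real.exp (2 * (κ₀ * (((d : ℝ) + 1) * (2 * (L : ℝ))))) * E₁ * E₃ * EK *
        ((N : ℝ) ^ (d + 1) * Zl (d + 1) (κ₀ / (4 * ((d : ℝ) + 1))) * Real.exp (-(κ₀ / 12) * (supNorm (z₁ - z₀) + supNorm (z₃ - z₀)))) := by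
  set C : ℝ := ((d : ℝ) + 1) * (2 * (L : ℝ)) ^ (d + 1) * Real.exp (2 * (κ₀ * (((d : ℝ) + 1) * (2 * (L : ℝ))))) * E₁ * EK with hC
  have hC0 : 0 ≤ C := by positivity
  have hin : ∀ μ z, |∑' u, ∑ κ, T κ u * K κ u μ z| ≤
      C * (Real.exp (-(κ₀ * supNorm (quo N z - z₁))) * Real.exp (-(κ₀ * supNorm (quo N z - z₀)))) :=
    fun μ z => (abs_inner_le' hN hκ.le hL hrr hE₁ hEK hT hKsupp hK μ z).2
  obtain ⟨hPs, hP⟩ := tsum_env3_le (d := d) hN hκ z₀ z₁ z₃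
  set P : (Fin (d + 1) → ℤ) → ℝ := fun u => Real.exp (-(κ₀ * supNorm (quo N u - z₀))) * Real.exp (-(κ₀ * supNorm (quo N u - z₁))) *
        Real.exp (-(κ₀ * supNorm (quo N u - z₃))) with hPdef
  have hpt : ∀ z, |∑ μ, M μ z * ∑' u, ∑ κ, T κ u * K κ u μ z| ≤ ((d : ℝ) + 1) * E₃ * C * P z := by
    intro z
    calc |∑ μ, M μ z * ∑' u, ∑ κ, T κ u * K κ u μ z| ≤ ∑ μ, |M μ z * ∑' u, ∑ κ, T κ u * K κ u μ z| := Finset.abs_sum_le_sum_abs _ _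
      _ ≤ ∑ _μ : Fin (d + 1), E₃ * C * P z := by
          refine Finset.sum_le_sum fun μ _ => ?_
          rw [abs_mul]
          calc |M μ z| * |∑' u, ∑ κ, T κ u * K κ u μ z|
              ≤ (E₃ * Real.exp (-(κ₀ * supNorm (quo N z - z₃)))) *
                  (C * (Real.exp (-(κ₀ * supNorm (quo N z - z₁))) * Real.exp (-(κ₀ * supNorm (quo N z - z₀))))) :=
                mul_le_mul (hM μ z) (hin μ z) (abs_nonneg _) (by positivity)
            _ = E₃ * C * P z := by rw [hPdef]; ring
      _ = ((d : ℝ) + 1) * E₃ * C * P z := by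
          rw [Finset.sum_const, Finset.card_univ, Fintype.card_fin, nsmul_eq_mul]; push_cast; ring
  have hSm : Summable fun z => ∑ μ, M μ z * ∑' u, ∑ κ, T κ u * K κ u μ z :=
    Summable.of_norm_bounded (hPs.mul_left (((d : ℝ) + 1) * E₃ * C)) (fun z => by rw [Real.norm_eq_abs]; exact hpt z)
  refine ⟨hSm, ?_⟩
  have h1 : |∑' z, ∑ μ, M μ z * ∑' u, ∑ κ, T κ u * K κ u μ z| ≤ ∑' z, ((d : ℝ) + 1) * E₃ * C * P z := by
    refine (norm_tsum_le_tsum_norm hSm.norm).trans ?_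
    simp only [Real.norm_eq_abs]
    exact Summable.tsum_le_tsum hpt hSm.abs (hPs.mul_left _)
  rw [tsum_mul_left] at h1
  have h2 : ((d : ℝ) + 1) * E₃ * C * ∑' z, P z ≤ ((d : ℝ) + 1) * E₃ * C *
      ((N : ℝ) ^ (d + 1) * Zl (d + 1) (κ₀ / (4 * ((d : ℝ) + 1))) * Real.exp (-(κ₀ / 12) * (supNorm (z₁ - z₀) + supNorm (z₃ - z₀)))) :=
    mul_le_mul_of_nonneg_left hP (by positivity)
  calc |∑' z, ∑ μ, M μ z * ∑' u, ∑ κ, T κ u * K κ u μ z| ≤ ((d : ℝ) + 1) * E₃ * C * ∑' z, P z := h1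
    _ ≤ _ := h2
    _ = _ := by rw [hC]; ring

/-- [folklore] **THE FLUCTUATION-SLOT BORDER CELL IN THE PUSH NESTING, BOUND**: the right-hand side of `push₃_gaugeLeft_border` with the legs `r β z′ = M`, `w κ′ u′ = T`,
`λ α x′ = ψ` under envelopes (`|M μ z| ≤ E₃E_{z₃}(z)`, `|T κ u| ≤ E₁E_{z₁}(u)`, `|ψ x| ≤ EψE_{z₀}(x)`):
`|Σ'_z Σ_μ M μ z · Σ'_u Σ_κ T κ u · ((ψ(u + e_κ) − ψ(z + ρ + L·e_μ))·q(u,z)(inl κ)(inr μ))| ≤ (the §4 letter with `E_K = 2Eψ·e^{κ₀(d+1)·2L}·ℓ`)`. -/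
theorem abs_cellVflu_le' (hN : 1 ≤ N) (hκ : 0 < κ₀) (hL : 1 ≤ L) (hrr : rr ∈ box (d + 1) L) {T : Form1 (d + 1) ℝ} {M : Fin (d + 1) → (Fin (d + 1) → ℤ) → ℝ}
    {ψ : (Fin (d + 1) → ℤ) → ℝ} {z₀ z₁ z₃ : Fin (d + 1) → ℤ} {E₁ E₃ Eψ : ℝ} (hE₁ : 0 ≤ E₁) (hE₃ : 0 ≤ E₃) (hEψ : 0 ≤ Eψ)
    (hT : ∀ κ u, |T κ u| ≤ E₁ * Real.exp (-(κ₀ * supNorm (quo N u - z₁))))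
    (hM : ∀ μ z, |M μ z| ≤ E₃ * Real.exp (-(κ₀ * supNorm (quo N z - z₃))))
    (hψ : ∀ x, |ψ x| ≤ Eψ * Real.exp (-(κ₀ * supNorm (quo N x - z₀)))) :
    |∑' z, ∑ μ, M μ z * ∑' u, ∑ κ, T κ u *
        ((ψ (u + unitVec κ) - ψ (z + toSite rr + (L : ℤ) • unitVec μ)) * linSymAt (toSite rr) L u z (Sum.inl κ) (Sum.inr μ))| ≤
      ((d : ℝ) + 1) ^ 2 * (2 * (L : ℝ)) ^ (d + 1) * Real.exp (2 * (κ₀ * (((d : ℝ) + 1) * (2 * (L : ℝ))))) * E₁ * E₃ *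
        (2 * Eψ * Real.exp (κ₀ * (((d : ℝ) + 1) * (2 * (L : ℝ)))) * (ell (d + 1) L : ℝ)) *
        ((N : ℝ) ^ (d + 1) * Zl (d + 1) (κ₀ / (4 * ((d : ℝ) + 1))) * Real.exp (-(κ₀ / 12) * (supNorm (z₁ - z₀) + supNorm (z₃ - z₀)))) :=
  (abs_cell_border_le' hN hκ hL hrr (K := fun κ u μ z =>
      (ψ (u + unitVec κ) - ψ (z + toSite rr + (L : ℤ) • unitVec μ)) * linSymAt (toSite rr) L u z (Sum.inl κ) (Sum.inr μ))
    hE₁ hE₃ (by positivity) hT hM (fun κ u μ z h hq => h (by simp only [hq, mul_zero]))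
    (fun κ u μ z => abs_fluWeight_mul_linSymAt_le hN hκ.le hL hrr hEψ hψ κ u μ z)).2

/-- [folklore] **THE INDEX-SLOT BORDER CELL IN THE PUSH NESTING, BOUND**: the right-hand side of `push₃_gaugeTable_border` with `r β z′ = M`, `l α x′ = T`, `λ κ′ u′ = ψ`:
`|Σ'_z Σ_μ M μ z · Σ'_x Σ_a T a x · ((ψ(z + ρ) − ψ x)·q(x,z)(inl a)(inr μ))| ≤ (same letter)`. -/
theorem abs_cellVidx_le' (hN : 1 ≤ N) (hκ : 0 < κ₀) (hL : 1 ≤ L) (hrr : rr ∈ box (d + 1) L) {T : Form1 (d + 1) ℝ} {M : Fin (d + 1) → (Fin (d + 1) → ℤ) → ℝ}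
    {ψ : (Fin (d + 1) → ℤ) → ℝ} {z₀ z₁ z₃ : Fin (d + 1) → ℤ} {E₁ E₃ Eψ : ℝ} (hE₁ : 0 ≤ E₁) (hE₃ : 0 ≤ E₃) (hEψ : 0 ≤ Eψ)
    (hT : ∀ a x, |T a x| ≤ E₁ * Real.exp (-(κ₀ * supNorm (quo N x - z₁))))
    (hM : ∀ μ z, |M μ z| ≤ E₃ * Real.exp (-(κ₀ * supNorm (quo N z - z₃))))
    (hψ : ∀ x, |ψ x| ≤ Eψ * Real.exp (-(κ₀ * supNorm (quo N x - z₀)))) :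
    |∑' z, ∑ μ, M μ z * ∑' x, ∑ a, T a x *
        ((ψ (z + toSite rr) - ψ x) * linSymAt (toSite rr) L x z (Sum.inl a) (Sum.inr μ))| ≤
      ((d : ℝ) + 1) ^ 2 * (2 * (L : ℝ)) ^ (d + 1) * Real.exp (2 * (κ₀ * (((d : ℝ) + 1) * (2 * (L : ℝ))))) * E₁ * E₃ *
        (2 * Eψ * Real.exp (κ₀ * (((d : ℝ) + 1) * (2 * (L : ℝ)))) * (ell (d + 1) L : ℝ)) *
        ((N : ℝ) ^ (d + 1) * Zl (d + 1) (κ₀ / (4 * ((d : ℝ) + 1))) * Real.exp (-(κ₀ / 12) * (supNorm (z₁ - z₀) + supNorm (z₃ - z₀)))) :=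
  (abs_cell_border_le' hN hκ hL hrr (K := fun a x μ z =>
      (ψ (z + toSite rr) - ψ x) * linSymAt (toSite rr) L x z (Sum.inl a) (Sum.inr μ))
    hE₁ hE₃ (by positivity) hT hM (fun a x μ z h hq => h (by simp only [hq, mul_zero]))
    (fun a x μ z => abs_idxWeight_mul_linSymAt_le hN hκ.le hL hrr hEψ hψ a x μ z)).2

end Cell

end Summit.QuantumFields.BalabanUV.Beta.GAN24.Push3BorderGaugeSlotCells

end
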